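import Summits.Ventures.HodgeRepro2.T5SchurIsotypicStep4
import Summits.Ventures.HodgeRepro2.T5SchurIsotypicSum
import Summits.Ventures.HodgeRepro2.T5FiniteSumDecomposition
import Summits.Ventures.HodgeRepro2.T5IsotypicHilbertSum

/-!
# T5IsotypicInvariantsFinite — «L_{π_∞} ∩ L^{K_f} = m_{K_f}(π_∞)·H_{π_∞}», with m_{K_f}(π_∞) finite

Cell pub-hodge-repro2, seat p5, Tier 5 (route/T5-N4-p5.md, N4.3 v13 (A3) STEP 5: «Fix K_f open
compact and an irreducible K_∞-type τ.  By STEP 2, L^{K_f} = ⊕̂_π m_{K_f}(π) H_π with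
m_{K_f}(π) H_π ⊂ L_π; by (β), L_{π_∞} ∩ L^{K_f} is orthogonal to m_{K_f}(π) H_π for every
π ≇ π_∞, hence L_{π_∞} ∩ L^{K_f} = m_{K_f}(π_∞) H_{π_∞}»).  This file is the Hilbert-space
bookkeeping of that sentence, on the abstract model of rows 37 / 38 (the isotypic parts
`L π := closure (⨆ i, H π i)` of pairwise inequivalent irreducible unitary `σ π`) and rows 53 /
65 / 72 / 75 (a DECOMPOSITION `S` of the invariants `Fx = L^{K_f}`: irreducible closed stable
subspaces, pairwise orthogonal, dense sum, finite unitary-equivalence classes):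

* `irreducible_restrict_of_irreducibleOn`: row 49's `IrreducibleOn ρ W` gives the irreducibility of
  the restricted representation in the `Submodule ℂ W` form used by rows 33 / 37;
* `existsUnique_le_isotypic_of_irreducibleOn`: every member of `S` lies in EXACTLY ONE `L π`
  (row 37's STEP 4 applied to the member);
* `isUnitaryEquiv_of_le_isotypic`, `finite_setOf_le_isotypic`: two members inside the same `L π`
  are unitarily equivalent (both are copies of `σ π`, row 33), so the members inside `L π` form a
  FINITE set `S_π` (the finite-multiplicity clause of [DE] Theorem 9.2.2, rows 53 / 65);
* `inf_closure_sSup_eq`: `L π ⊓ Fx = closure (sSup S_π)` (row 16's `inf_closure_iSup_eq`, the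
  pairwise orthogonality of the `L π` being row 35's (β));
* `isClosed_sup_of_isOrtho`, `isClosed_sSup_of_finite`: the sum of two closed orthogonal subspaces
  of a Hilbert space is closed (the two orthogonal projections), hence so is a finite orthogonal
  sum;
* **`inf_eq_sSup_of_decomposition`**: `L π ⊓ Fx = sSup S_π`, `S_π` FINITE, every member of `S_π`
  a copy of `σ π` — the displayed identity with `m_{K_f}(π) = #S_π < ∞`.

What stays prose in STEP 5: the τ-isotypic dimension count on the finite sum (row 25's
`finrank_isotypicComponent_pi` in the algebraic form) and the admissibility of `π_∞` ([KV]
Thm 0.3).  Imports rows 16 / 33 / 35 / 37 / 38 / 49 / 53 / 71 / 72 and Mathlib.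
Axioms: propext, Classical.choice, Quot.sound.
README §8(d): uses an L-value-free non-vanishing device: NO.
-/

namespace Summit.Ventures.HodgeRepro2.T5IsotypicInvariantsFinite

open Summit.Ventures.HodgeRepro2.T5CompactDiscreteDecomposition (IrreducibleOn)
open Summit.Ventures.HodgeRepro2.T5FiniteMultiplicity (IsUnitaryEquiv)
open Summit.Ventures.HodgeRepro2.T5SchurIsotypicStep4 (exists_restrictRep existsUnique_le_isotypic)
open Summit.Ventures.HodgeRepro2.T5SchurIsotypicSum (isClosed_map_subtype)
open Summit.Ventures.HodgeRepro2.T5SchurIsotypicCopy (exists_linearIsometryEquiv_of_irreducible)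
open Summit.Ventures.HodgeRepro2.T5SchurIsotypicUnique (isOrtho_closure_iSup_of_not_equiv)
open Summit.Ventures.HodgeRepro2.T5IsotypicHilbertSum (inf_closure_iSup_eq)
open scoped InnerProductSpace

variable {E : Type*} [NormedAddCommGroup E] [InnerProductSpace ℂ E] [CompleteSpace E]
variable {G : Type*} [Group G]

/-! ### Finite orthogonal sums of closed subspaces are closed -/

/-- **The sum of two closed orthogonal subspaces of a Hilbert space is closed.**  For `x` in the
closure `(U ⊔ V)ᗮᗮ`, the vector `y = x - (P_U x + P_V x)` lies in `Uᗮ ⊓ Vᗮ = (U ⊔ V)ᗮ` (the two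
orthogonal projections), so `⟪y, y⟫ = ⟪y, x⟫ - ⟪y, P_U x + P_V x⟫ = 0` and `x = P_U x + P_V x`. -/
theorem isClosed_sup_of_isOrtho {U V : Submodule ℂ E} (hU : IsClosed (U : Set E))
    (hV : IsClosed (V : Set E)) (h : U ⟂ V) : IsClosed ((U ⊔ V : Submodule ℂ E) : Set E) := by
  haveI : CompleteSpace U := hU.completeSpace_coe
  haveI : CompleteSpace V := hV.completeSpace_coe
  have hUV : U ≤ Vᗮ := Submodule.isOrtho_iff_le.mp h
  have hVU : V ≤ Uᗮ := Submodule.isOrtho_iff_le.mp h.symm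
  have hle : (U ⊔ V).topologicalClosure ≤ U ⊔ V := by
    intro x hx
    rw [← Submodule.orthogonal_orthogonal_eq_closure] at hx
    set y : E := x - (U.starProjection x + V.starProjection x) with hy
    have hyU : y ∈ Uᗮ := by
      have h1 : x - U.starProjection x ∈ Uᗮ := Submodule.sub_starProjection_mem_orthogonal x
      have h2 : V.starProjection x ∈ Uᗮ := hVU (Submodule.starProjection_apply_mem V x)
      rw [hy, sub_add_eq_sub_sub]
      exact Uᗮ.sub_mem h1 h2
    have hyV : y ∈ Vᗮ := by
      have h1 : x - V.starProjection x ∈ Vᗮ := Submodule.sub_starProjection_mem_orthogonal x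
      have h2 : U.starProjection x ∈ Vᗮ := hUV (Submodule.starProjection_apply_mem U x)
      rw [hy, add_comm, sub_add_eq_sub_sub]
      exact Vᗮ.sub_mem h1 h2
    have hyO : y ∈ (U ⊔ V)ᗮ := by
      rw [← Submodule.inf_orthogonal]
      exact ⟨hyU, hyV⟩
    have hsum : U.starProjection x + V.starProjection x ∈ U ⊔ V :=
      Submodule.add_mem_sup (Submodule.starProjection_apply_mem U x)
        (Submodule.starProjection_apply_mem V x)
    have e1 : ⟪y, x⟫_ℂ = 0 := Submodule.inner_right_of_mem_orthogonal hyO hx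
    have e2 : ⟪y, U.starProjection x + V.starProjection x⟫_ℂ = 0 :=
      Submodule.inner_left_of_mem_orthogonal hsum hyO
    have h0 : ⟪y, y⟫_ℂ = 0 := by
      have : ⟪y, y⟫_ℂ = ⟪y, x⟫_ℂ - ⟪y, U.starProjection x + V.starProjection x⟫_ℂ := by
        rw [← inner_sub_right]
      rw [this, e1, e2, sub_zero]
    have hy0 : y = 0 := inner_self_eq_zero.mp h0
    have hx' : x = U.starProjection x + V.starProjection x := sub_eq_zero.mp hy0
    rw [hx']
    exact hsum
  have hcl : (U ⊔ V).topologicalClosure = U ⊔ V :=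
    le_antisymm hle (Submodule.le_topologicalClosure _)
  rw [← hcl]
  exact Submodule.isClosed_topologicalClosure _

/-- **A finite pairwise-orthogonal family of closed subspaces has a closed sum.** -/
theorem isClosed_sSup_of_finite {S : Set (Submodule ℂ E)} (hS : S.Finite)
    (hc : ∀ U ∈ S, IsClosed (U : Set E)) (ho : S.Pairwise (fun U V => U ⟂ V)) :
    IsClosed ((sSup S : Submodule ℂ E) : Set E) := by
  revert hc ho
  refine Set.Finite.induction_on (motive := fun (s : Set (Submodule ℂ E)) _ =>
    (∀ U ∈ s, IsClosed (U : Set E)) → s.Pairwise (fun U V => U ⟂ V) →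
      IsClosed ((sSup s : Submodule ℂ E) : Set E)) S hS ?_ ?_
  · intro _ _
    rw [sSup_empty, Submodule.bot_coe]
    exact isClosed_singleton
  · intro a s has _ ih hc ho
    rw [sSup_insert]
    refine isClosed_sup_of_isOrtho (hc a (Set.mem_insert a s))
      (ih (fun U hU => hc U (Set.mem_insert_of_mem a hU)) (ho.mono (Set.subset_insert a s))) ?_
    rw [Submodule.isOrtho_sSup_right]
    intro b hb
    exact ho (Set.mem_insert a s) (Set.mem_insert_of_mem a hb) (fun hab => has (hab ▸ hb))

/-! ### `IrreducibleOn` in the restricted form -/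

omit [CompleteSpace E] in
/-- Row 49's `IrreducibleOn ρ W` gives the irreducibility of the restricted representation `ρW`
on `W` in the form used by rows 33 / 37: a closed `ρW`-stable subspace of `W` is `⊥` or `⊤`
(its image in `E` is a closed stable subspace of `W`, hence `⊥` or `W`; `W.subtype` is
injective). -/
theorem irreducible_restrict_of_irreducibleOn {ρ : G →* (E →L[ℂ] E)} {W : Submodule ℂ E}
    (hW : IrreducibleOn ρ W) (ρW : G →* (W →L[ℂ] W))
    (hρW : ∀ g (w : W), (ρW g w : E) = ρ g w) :
    ∀ C : Submodule ℂ W, IsClosed (C : Set W) → (∀ g, ∀ x ∈ C, ρW g x ∈ C) → C = ⊥ ∨ C = ⊤ := by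
  intro C hCc hCs
  obtain ⟨hWc, -, -, hWmin⟩ := hW
  have hinj : Function.Injective W.subtype := Subtype.coe_injective
  have hmapc : IsClosed ((C.map W.subtype : Submodule ℂ E) : Set E) :=
    isClosed_map_subtype hWc hCc
  have hmaps : ∀ g, ∀ v ∈ C.map W.subtype, ρ g v ∈ C.map W.subtype := by
    intro g v hv
    rcases Submodule.mem_map.mp hv with ⟨c, hc, rfl⟩
    exact Submodule.mem_map.mpr ⟨ρW g c, hCs g c hc, hρW g c⟩
  have hle : C.map W.subtype ≤ W := Submodule.map_subtype_le W C
  rcases hWmin _ hle hmapc hmaps with h | h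
  · left
    exact Submodule.map_injective_of_injective hinj (by rw [h, Submodule.map_bot])
  · right
    exact Submodule.map_injective_of_injective hinj (by rw [h, Submodule.map_subtype_top])

/-! ### Every member of a decomposition lies in exactly one isotypic part -/

variable {P : Type*} {F : P → Type*} [∀ π, NormedAddCommGroup (F π)]
  [∀ π, InnerProductSpace ℂ (F π)] [∀ π, CompleteSpace (F π)]

/-- **STEP 4 for a member of the decomposition**: an irreducible closed stable subspace `W` of `E`
lies in exactly one isotypic part `L π = closure (⨆ i, H π i)` (row 37's
`existsUnique_le_isotypic`, with the restricted representation of `exists_restrictRep`). -/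
theorem existsUnique_le_isotypic_of_irreducibleOn {ρ : G →* (E →L[ℂ] E)}
    (hρ : ∀ g, star (ρ g) = ρ g⁻¹)
    (σ : ∀ π, G →* (F π →L[ℂ] F π)) (hσ : ∀ π g, star (σ π g) = σ π g⁻¹)
    (hσirr : ∀ π, ∀ V : Submodule ℂ (F π), IsClosed (V : Set (F π)) →
      (∀ g, ∀ v ∈ V, σ π g v ∈ V) → V = ⊥ ∨ V = ⊤)
    (hne : ∀ π π', π ≠ π' → ∀ V : F π ≃ₗᵢ[ℂ] F π', ¬ ∀ g x, V (σ π g x) = σ π' g (V x))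
    {ι : P → Type*} (H : ∀ π, ι π → Submodule ℂ E) (hHc : ∀ π i, IsClosed (H π i : Set E))
    (hHs : ∀ π i g, ∀ x ∈ H π i, ρ g x ∈ H π i)
    (U : ∀ π i, F π ≃ₗᵢ[ℂ] H π i) (hU : ∀ π i g x, ((U π i) (σ π g x) : E) = ρ g (U π i x))
    (hdense : (⨆ π, (⨆ i, H π i).topologicalClosure).topologicalClosure = ⊤)
    {W : Submodule ℂ E} (hW : IrreducibleOn ρ W) :
    ∃! π, W ≤ (⨆ i, H π i).topologicalClosure := by
  obtain ⟨ρW, hρW⟩ := exists_restrictRep ρ hW.2.1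
  exact existsUnique_le_isotypic hρ σ hσ hσirr hne H hHc hHs U hU hdense hW.1 hW.2.2.1 ρW hρW
    (irreducible_restrict_of_irreducibleOn hW ρW hρW)

/-! ### The members inside one isotypic part are finitely many -/

/-- **Two irreducible closed stable subspaces inside the same isotypic part are unitarily
equivalent**: both are copies of `σ` (row 33), and the composite of the two intertwining
isometries intertwines `ρ`. -/
theorem isUnitaryEquiv_of_le_isotypic {ρ : G →* (E →L[ℂ] E)} (hρ : ∀ g, star (ρ g) = ρ g⁻¹)
    {F₀ : Type*} [NormedAddCommGroup F₀] [InnerProductSpace ℂ F₀] [CompleteSpace F₀]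
    [Nontrivial F₀] {σ : G →* (F₀ →L[ℂ] F₀)} (hσ : ∀ g, star (σ g) = σ g⁻¹)
    (hσirr : ∀ V : Submodule ℂ F₀, IsClosed (V : Set F₀) →
      (∀ g, ∀ v ∈ V, σ g v ∈ V) → V = ⊥ ∨ V = ⊤)
    {ι : Type*} (H : ι → Submodule ℂ E) (hHc : ∀ i, IsClosed (H i : Set E))
    (hHs : ∀ i g, ∀ x ∈ H i, ρ g x ∈ H i)
    (U : ∀ i, F₀ ≃ₗᵢ[ℂ] H i) (hU : ∀ i g x, ((U i) (σ g x) : E) = ρ g (U i x))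
    {W₀ W₁ : Submodule ℂ E} (hW₀ : IrreducibleOn ρ W₀) (hW₁ : IrreducibleOn ρ W₁)
    (h₀ : W₀ ≤ (⨆ i, H i).topologicalClosure) (h₁ : W₁ ≤ (⨆ i, H i).topologicalClosure) :
    IsUnitaryEquiv ρ W₀ W₁ := by
  obtain ⟨ρ₀, hρ₀⟩ := exists_restrictRep ρ hW₀.2.1
  obtain ⟨ρ₁, hρ₁⟩ := exists_restrictRep ρ hW₁.2.1
  obtain ⟨V₀, hV₀⟩ := exists_linearIsometryEquiv_of_irreducible hρ hσ hσirr H hHc hHs U hU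
    hW₀.1 h₀ hW₀.2.2.1 ρ₀ hρ₀ (irreducible_restrict_of_irreducibleOn hW₀ ρ₀ hρ₀)
  obtain ⟨V₁, hV₁⟩ := exists_linearIsometryEquiv_of_irreducible hρ hσ hσirr H hHc hHs U hU
    hW₁.1 h₁ hW₁.2.2.1 ρ₁ hρ₁ (irreducible_restrict_of_irreducibleOn hW₁ ρ₁ hρ₁)
  refine ⟨V₀.symm.trans V₁, ?_⟩
  intro g w h
  have hw : V₀ (V₀.symm w) = w := V₀.apply_symm_apply w
  have hgw : (⟨ρ g w, h⟩ : W₀) = V₀ (σ g (V₀.symm w)) := by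
    apply Subtype.ext
    change (ρ g w : E) = ((V₀ (σ g (V₀.symm w)) : W₀) : E)
    rw [hV₀ g (V₀.symm w), hw]
  simp only [LinearIsometryEquiv.trans_apply]
  rw [hgw, LinearIsometryEquiv.symm_apply_apply, hV₁ g (V₀.symm w)]

/-- **The members of a decomposition inside one isotypic part form a FINITE set**: they are
pairwise unitarily equivalent, and every unitary-equivalence class of the decomposition is finite
(the finite-multiplicity clause of [DE] Theorem 9.2.2). -/
theorem finite_setOf_le_isotypic {ρ : G →* (E →L[ℂ] E)} (hρ : ∀ g, star (ρ g) = ρ g⁻¹)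
    {F₀ : Type*} [NormedAddCommGroup F₀] [InnerProductSpace ℂ F₀] [CompleteSpace F₀]
    [Nontrivial F₀] {σ : G →* (F₀ →L[ℂ] F₀)} (hσ : ∀ g, star (σ g) = σ g⁻¹)
    (hσirr : ∀ V : Submodule ℂ F₀, IsClosed (V : Set F₀) →
      (∀ g, ∀ v ∈ V, σ g v ∈ V) → V = ⊥ ∨ V = ⊤)
    {ι : Type*} (H : ι → Submodule ℂ E) (hHc : ∀ i, IsClosed (H i : Set E))
    (hHs : ∀ i g, ∀ x ∈ H i, ρ g x ∈ H i)
    (U : ∀ i, F₀ ≃ₗᵢ[ℂ] H i) (hU : ∀ i g x, ((U i) (σ g x) : E) = ρ g (U i x))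
    {S : Set (Submodule ℂ E)} (hS : ∀ W ∈ S, IrreducibleOn ρ W)
    (hfin : ∀ W₀ ∈ S, {W ∈ S | IsUnitaryEquiv ρ W₀ W}.Finite) :
    {W ∈ S | W ≤ (⨆ i, H i).topologicalClosure}.Finite := by
  by_cases hex : ∃ W₀ ∈ S, W₀ ≤ (⨆ i, H i).topologicalClosure
  · obtain ⟨W₀, hW₀S, hW₀le⟩ := hex
    refine (hfin W₀ hW₀S).subset ?_
    intro W₁ hW₁
    exact ⟨hW₁.1, isUnitaryEquiv_of_le_isotypic hρ hσ hσirr H hHc hHs U hU (hS W₀ hW₀S)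
      (hS W₁ hW₁.1) hW₀le hW₁.2⟩
  · push Not at hex
    have hempty : {W ∈ S | W ≤ (⨆ i, H i).topologicalClosure} = ∅ := by
      ext W
      simp only [Set.mem_setOf_eq, Set.mem_empty_iff_false, iff_false, not_and]
      exact hex W
    rw [hempty]
    exact Set.finite_empty

/-! ### `L π ⊓ Fx = closure (sSup S_π)` -/

/-- **The intersection of an isotypic part with the closed span of a decomposition** is the closed
span of the members lying in that isotypic part: row 16's `inf_closure_iSup_eq` for
`N π := sSup {W ∈ S | W ≤ L π}`, the `L π` being pairwise orthogonal by row 35's (β) and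
`⨆ π, N π = sSup S` because every member lies in some `L π`. -/
theorem inf_closure_sSup_eq {ρ : G →* (E →L[ℂ] E)} (hρ : ∀ g, star (ρ g) = ρ g⁻¹)
    (σ : ∀ π, G →* (F π →L[ℂ] F π)) (hσ : ∀ π g, star (σ π g) = σ π g⁻¹)
    (hσirr : ∀ π, ∀ V : Submodule ℂ (F π), IsClosed (V : Set (F π)) →
      (∀ g, ∀ v ∈ V, σ π g v ∈ V) → V = ⊥ ∨ V = ⊤)
    (hne : ∀ π π', π ≠ π' → ∀ V : F π ≃ₗᵢ[ℂ] F π', ¬ ∀ g x, V (σ π g x) = σ π' g (V x))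
    {ι : P → Type*} (H : ∀ π, ι π → Submodule ℂ E) (hHc : ∀ π i, IsClosed (H π i : Set E))
    (hHs : ∀ π i g, ∀ x ∈ H π i, ρ g x ∈ H π i)
    (U : ∀ π i, F π ≃ₗᵢ[ℂ] H π i) (hU : ∀ π i g x, ((U π i) (σ π g x) : E) = ρ g (U π i x))
    (hdense : (⨆ π, (⨆ i, H π i).topologicalClosure).topologicalClosure = ⊤)
    {S : Set (Submodule ℂ E)} (hS : ∀ W ∈ S, IrreducibleOn ρ W) (π : P) :
    (⨆ i, H π i).topologicalClosure ⊓ (sSup S).topologicalClosure =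
      (sSup {W ∈ S | W ≤ (⨆ i, H π i).topologicalClosure}).topologicalClosure := by
  let L : P → Submodule ℂ E := fun π => (⨆ i, H π i).topologicalClosure
  let N : P → Submodule ℂ E := fun π => sSup {W ∈ S | W ≤ L π}
  have hLo : Pairwise (fun π π' => L π ⟂ L π') := by
    intro π π' hππ'
    exact isOrtho_closure_iSup_of_not_equiv hρ (hσ π) (hσirr π) (hσ π') (hσirr π') (H π) (U π)
      (hU π) (H π') (hHc π') (hHs π') (U π') (hU π') (hne π π' hππ')
  have hNL : ∀ π, N π ≤ L π := fun π => sSup_le (fun W hW => hW.2)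
  have hsup : iSup N = sSup S := by
    apply le_antisymm
    · exact iSup_le (fun π => sSup_le_sSup (fun W hW => hW.1))
    · refine sSup_le (fun W hW => ?_)
      have hex := existsUnique_le_isotypic_of_irreducibleOn hρ σ hσ hσirr hne H hHc hHs U hU
        hdense (hS W hW)
      obtain ⟨π', hπ'⟩ := hex.exists
      have hmem : W ∈ {W ∈ S | W ≤ L π'} := ⟨hW, hπ'⟩
      exact le_trans (le_sSup hmem) (le_iSup N π')
  have key := inf_closure_iSup_eq L N hLo hNL π (Submodule.isClosed_topologicalClosure _)
  rw [hsup] at key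
  exact key

/-! ### The assembly: `L π ⊓ Fx = sSup S_π`, `S_π` finite, every member a copy of `σ π` -/

/-- **«L_{π_∞} ∩ L^{K_f} = m_{K_f}(π_∞)·H_{π_∞}, with m_{K_f}(π_∞) finite»** (N4.3 (A3) STEP 5).
For the isotypic parts `L π = closure (⨆ i, H π i)` of pairwise inequivalent irreducible unitary
`σ π` with dense sum, and a decomposition `S` of the closed subspace `Fx` (irreducible closed
stable members, pairwise orthogonal, `closure (sSup S) = Fx`, every unitary-equivalence class
finite — the conclusion shape of rows 53 / 65 / 72 / 75), the members lying in `L π` form a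
FINITE set `S_π`, `L π ⊓ Fx` is their (closed) orthogonal sum `sSup S_π`, and every member of
`S_π` is a copy of `σ π`. -/
theorem inf_eq_sSup_of_decomposition {ρ : G →* (E →L[ℂ] E)} (hρ : ∀ g, star (ρ g) = ρ g⁻¹)
    (σ : ∀ π, G →* (F π →L[ℂ] F π)) (hσ : ∀ π g, star (σ π g) = σ π g⁻¹)
    (hσirr : ∀ π, ∀ V : Submodule ℂ (F π), IsClosed (V : Set (F π)) →
      (∀ g, ∀ v ∈ V, σ π g v ∈ V) → V = ⊥ ∨ V = ⊤)
    (hne : ∀ π π', π ≠ π' → ∀ V : F π ≃ₗᵢ[ℂ] F π', ¬ ∀ g x, V (σ π g x) = σ π' g (V x))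
    {ι : P → Type*} (H : ∀ π, ι π → Submodule ℂ E) (hHc : ∀ π i, IsClosed (H π i : Set E))
    (hHs : ∀ π i g, ∀ x ∈ H π i, ρ g x ∈ H π i)
    (U : ∀ π i, F π ≃ₗᵢ[ℂ] H π i) (hU : ∀ π i g x, ((U π i) (σ π g x) : E) = ρ g (U π i x))
    (hdense : (⨆ π, (⨆ i, H π i).topologicalClosure).topologicalClosure = ⊤)
    {Fx : Submodule ℂ E} {S : Set (Submodule ℂ E)} (hS : ∀ W ∈ S, IrreducibleOn ρ W)
    (hSo : S.Pairwise (fun W W' => W ⟂ W')) (hSd : (sSup S).topologicalClosure = Fx)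
    (hfin : ∀ W₀ ∈ S, {W ∈ S | IsUnitaryEquiv ρ W₀ W}.Finite) (π : P) [Nontrivial (F π)] :
    {W ∈ S | W ≤ (⨆ i, H π i).topologicalClosure}.Finite ∧
      (⨆ i, H π i).topologicalClosure ⊓ Fx =
        sSup {W ∈ S | W ≤ (⨆ i, H π i).topologicalClosure} ∧
      ∀ W ∈ {W ∈ S | W ≤ (⨆ i, H π i).topologicalClosure},
        ∃ V : F π ≃ₗᵢ[ℂ] W, ∀ g x, (V (σ π g x) : E) = ρ g (V x) := by
  have hSπ : {W ∈ S | W ≤ (⨆ i, H π i).topologicalClosure}.Finite :=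
    finite_setOf_le_isotypic hρ (hσ π) (hσirr π) (H π) (hHc π) (hHs π) (U π) (hU π) hS hfin
  refine ⟨hSπ, ?_, ?_⟩
  · have hcl : IsClosed ((sSup {W ∈ S | W ≤ (⨆ i, H π i).topologicalClosure} :
        Submodule ℂ E) : Set E) :=
      isClosed_sSup_of_finite hSπ (fun W hW => (hS W hW.1).1)
        (hSo.mono (fun W hW => hW.1))
    rw [← hSd, inf_closure_sSup_eq hρ σ hσ hσirr hne H hHc hHs U hU hdense hS π,
      hcl.submodule_topologicalClosure_eq]
  · intro W hW
    obtain ⟨ρW, hρW⟩ := exists_restrictRep ρ (hS W hW.1).2.1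
    exact exists_linearIsometryEquiv_of_irreducible hρ (hσ π) (hσirr π) (H π) (hHc π) (hHs π)
      (U π) (hU π) (hS W hW.1).1 hW.2 (hS W hW.1).2.2.1 ρW hρW
      (irreducible_restrict_of_irreducibleOn (hS W hW.1) ρW hρW)

end Summit.Ventures.HodgeRepro2.T5IsotypicInvariantsFinite
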